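import Literature.AlgebraicGeometry.AbelianSchemes.CechH1DimOfPoincareData
import Literature.AlgebraicGeometry.AbelianSchemes.MumfordDualOfConnectedAffineAnyChar
import Literature.AlgebraicGeometry.AbelianSchemes.MumfordQuotientConstructionRelDim
import Literature.AlgebraicGeometry.AbelianSchemes.AbelianSchemeKOfLEtaleOfInvertibleOrder
import Literature.AlgebraicGeometry.AbelianSchemes.AbelianSchemeKOfLBaseChange
import Literature.AlgebraicGeometry.AbelianSchemes.StageDualsOfLetterCharts
import Literature.AlgebraicGeometry.AbelianSchemes.SymplecticLiftableOfOnePoint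
import Literature.AlgebraicGeometry.AbelianVarieties.CechH1DimReduceToFieldExtension
import Literature.AlgebraicGeometry.Morphisms.GeometricPointsLiftSurjective
import HarnessLib

/-!
# `dim_K Ȟ¹(𝔘, 𝒪_A) = dim A` FOR THE DUALS LETTER'S DATA, ANY CHARACTERISTIC, ANY FIELD — the `H¹`-count input `hH1` of the road-(A)
# `stub_DUALS` chain, DISCHARGED over ★ `finite_finrank_cechH1_eq_of_poincareData` ([MumfordAV1970] §13 Cor. 2)

Layer `Literature/AlgebraicGeometry/AbelianSchemes`, namespace `Literature.AlgebraicGeometry.AbelianSchemes.MumfordDual`.  THEOREMS ONLY (no definition,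
no named fact, no instance, no notation, no `sorry`).  Cell `hodgecm-mathlib` (D-0151), P6 «MOD programme», L4 DUALS road-(A) (LA4-plan (g0) DEAL #15,
B-p04 (g42) 2026-09-02T03:59:39Z «= with ONE BRIDGE (GEO)+(DESC)»; LA6-p02 (g0) pen; (DESC) `rfl` reading LA4-p05 (g2)).

THE THEOREMS.
* `nonempty_levelStructure_baseChange_of_isAlgClosed` — over an ALGEBRAICALLY CLOSED field `Ω` with `n ∈ Ω^×`, the base change `A_Ω` of an abelian
  scheme (relative dimension `g`) carries a level-`n` structure ([MumfordFogartyKirwan1994] Ch. 7 §2 Def. 7.1, §3 Lemma 7.11: the level-`n`-basis cover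
  ★ `exists_connected_levelCover_free_geometricQuotient_of_isUnit` is finite étale surjective, hence has an `Ω`-section ★ `exists_comp_eq_of_surjective`;
  the cover's level structure moves to `A ×_S S″` along ★ `baseChangeCompGrpIso` (★ `LevelStructure.exists_comp_of_iso`) and restricts along the section
  (★ `LevelStructure.nonempty_baseChange_comp`)).
* `finite_finrank_cechH1_eq_of_letter_geometricPoint` — (GEO): for `A₀ → Spec K₁` PROJECTIVE abelian of relative dimension `g` with a rank-one `L₀`
  rigidified along the unit section, of ample class on every geometric fibre, `n ∈ K₁^×` killing `K(L₀)`, and a geometric point `t : Spec Ω → Spec K₁`: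
  every finite affine open cover of `(A₀)_Ω` has `Ȟ¹(𝔘, 𝒪)` finite of rank `g` over `Ω` — (K′) ★ `exists_kOfL_etale_of_isUnit` (`K(L₀)` finite étale
  killed by `n`), a level-`n` structure on `(A₀)_Ω` (above), ★ `exists_finite_subgroup_memKOfL_iff_baseChange` (`K(L₀)_Ω` is the constant group on
  finitely many sections), Mumford's construction ★ `exists_quotient_poincare_relDim_of_constant_kOfL_baseChange_of_isLocallyNoetherian` (LA4-p05 (g2):
  `Â = A⁄K(L)`, `π`, the descended Poincaré sheaf `𝒫` with `(1 × π)^*𝒫 ≅ Λ(L)`, `Pic⁰` slices, `Â` of relative dimension `g`), and the HEAD ★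
  `finite_finrank_cechH1_eq_of_poincareData` (B-p04 (g42), [MumfordAV1970] §13 Cor. 2 from the Poincaré family).
* `finite_finrank_cechH1_eq_dim_of_letter_field` — **[MumfordAV1970] §13 Cor. 2 for the letter's data over ANY field `K₁`**: rank `dim A₀` over `K₁` for
  every finite affine open cover of `A₀` — (DESC) ★ `finrank_cechH1_structureSheaf_eq_dim_of_algClosure` (flat base change of Čech cohomology to `K̄₁`;
  `(A₀)_{K̄₁}` as `AbelianSchemeOver.baseChange` and as ★ `AbelianVariety.baseChange` agree by `rfl`, LA4-p05 (g2)) + (GEO) at `Spec K̄₁ → Spec K₁`.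
* `hH1_of_letter` — the uniform `hH1` hypothesis of ★ `MumfordDual.nonempty_dualPair_of_isProjective_of_split` (file (4) of the chain), for an abelian
  scheme over a Noetherian ring carrying the DUALS letter's data `(hA, L, hL, hε, hΘ, n, hn, hkill)`: at every field point `s` of every base change
  `A ×_R S′` the count holds — the previous theorem at the fibre `(A ×_R S′)_s`, whose data are the letter's transported along the two cartesian squares
  (★ `IsBaseChangeVia.trans` ∕ `pullback_unitSection_detClass_pullback_eq_one` ∕ `exists_isAmple_cechClass_fibre_pullback` ∕ `pow_eq_one_of_memKOfL_pullback`).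

HC_CM is proved only modulo the printed citations (2 remaining named inputs hLiu418 24832, h413 24833) until rung 0 closes; this file is count-neutral ★
capital (it removes the `hHead` hole of ★ `DualPairOfAmpleRigidified`, edition 2) and asserts nothing about HC.

## References
* [MumfordAV1970] D. Mumford, *Abelian Varieties* (1970), §13 Theorem (p. 125), its proof (pp. 125–129) and Cor. 2 (p. 129); §23 (p. 231); §7 Thm. 4 (p. 72).
* [MumfordFogartyKirwan1994] D. Mumford, J. Fogarty, F. Kirwan, *Geometric Invariant Theory*, 3rd ed. (1994), Ch. 6 §1 Cor. 6.8 (p. 118), §2 (p. 121);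
  Ch. 7 §2 Def. 7.1 (p. 129), §3 Lemma 7.11 (p. 140).
* [StacksProject] The Stacks Project, Tag 02KH (flat base change of Čech cohomology).
* [GortzWedhorn2020] U. Görtz, T. Wedhorn, *Algebraic Geometry I*, 2nd ed. (2020), Cor. 3.36 (p. 83), Section (4.7) (pp. 107–108).
-/

set_option autoImplicit false

noncomputable section

-- `Scheme.Modules` / cartesian-monoidal `Over` products / `AbelianVariety.baseChange` vs `AbelianSchemeOver.baseChange` agree only at default
-- transparency (as in ★ `CechH1DimOfPoincareData`, ★ `MumfordQuotientConstructionAnyChar`).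
set_option backward.isDefEq.respectTransparency false

open CategoryTheory CategoryTheory.Limits AlgebraicGeometry MonoidalCategory CartesianMonoidalCategory
open scoped MonObj
open Literature.AlgebraicGeometry.AbelianSchemes Literature.AlgebraicGeometry.Motives Literature.AlgebraicGeometry.AbelianVarieties
open Literature.AlgebraicGeometry.Modules
open Literature.AlgebraicGeometry.Morphisms (IsProjective CechH1 exists_comp_eq_of_surjective)

namespace Literature.AlgebraicGeometry.AbelianSchemes

namespace MumfordDual

/-! ## §1 A level structure over an algebraically closed field -/

/-- **Over an algebraically closed field `Ω` with `n ∈ Ω^×`, the base change `A_Ω` of an abelian scheme (relative dimension `g`) carries a level-`n`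
structure** ([MumfordFogartyKirwan1994] Ch. 7 §2 Def. 7.1; §3 Lemma 7.11): the level-`n`-basis cover of `Spec Ω` (★
`exists_connected_levelCover_free_geometricQuotient_of_isUnit`) is finite étale surjective, so it has an `Ω`-valued section (★ `exists_comp_eq_of_surjective`),
and the cover's level structure restricts along it (★ `LevelStructure.nonempty_baseChange_comp`, twice).
[cite: MumfordFogartyKirwan1994, Ch. 7 §2 Definition 7.1 (p. 129) and §3 Lemma 7.11 (p. 140)] [cite: GortzWedhorn2020, Cor. 3.36 (p. 83)] -/
theorem nonempty_levelStructure_baseChange_of_isAlgClosed {S : Scheme.{0}} (A : AbelianSchemeOver S) (Ω : Type) [Field Ω] [IsAlgClosed Ω]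
    (f : Spec (.of Ω) ⟶ S) {g : ℕ} (hg : (A.baseChange f).IsOfRelDim g) (n : ℕ) [NeZero n] (hn : IsUnit ((n : ℕ) : Ω)) :
    Nonempty (AbelianSchemeOver.LevelStructure g n (A.baseChange f)) := by
  obtain ⟨S'', p'', _, _, _, hfin, _, hsurj, G, _, _, ρ, -, -, ⟨φ''⟩⟩ :=
    (A.baseChange f).exists_connected_levelCover_free_geometricQuotient_of_isUnit Ω hg n hn
  haveI := hfin
  haveI := hsurj
  -- an `Ω`-valued section of the finite étale surjective cover
  obtain ⟨σ, hσ⟩ := exists_comp_eq_of_surjective p'' (𝟙 (Spec (.of Ω)))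
  -- the cover's level structure on `(A_Ω) ×_Ω S″ ≅ A ×_S S″` (★ `baseChangeCompGrpIso`, ★ `LevelStructure.exists_comp_of_iso`)
  let E := A.baseChangeCompGrpIso f p''
  let e : ((A.baseChange f).baseChange p'').X ≅ (A.baseChange (p'' ≫ f)).X :=
    { hom := E.inv.hom.hom
      inv := E.hom.hom.hom
      hom_inv_id := by
        change (E.inv ≫ E.hom).hom.hom = _
        rw [E.inv_hom_id]
        rfl
      inv_hom_id := by
        change (E.hom ≫ E.inv).hom.hom = _
        rw [E.hom_inv_id]
        rfl }
  haveI : IsMonHom e.hom := by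
    change IsMonHom E.inv.hom.hom
    infer_instance
  obtain ⟨φ₂, -⟩ := AbelianSchemeOver.LevelStructure.exists_comp_of_iso e φ''
  -- … restricted along the section
  have h := AbelianSchemeOver.LevelStructure.nonempty_baseChange_comp A (p'' ≫ f) σ φ₂
  rwa [← Category.assoc, hσ, Category.id_comp] at h

/-! ## §2 The count for the letter's data over a field, and the chain's `hH1` -/

/-- **[MumfordAV1970] §13 Cor. 2 FOR THE DUALS LETTER'S DATA OVER ANY FIELD**: for `A₀ → Spec K₁` a PROJECTIVE abelian scheme, `L₀` rank one rigidified
along the unit section with ample class on every geometric fibre, and `n ∈ K₁^×` with `K(L₀)` killed by `n`: for every finite affine open cover `𝔘` of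
`A₀`, `Ȟ¹(𝔘, 𝒪)` is a finite `K₁`-module of rank `dim A₀` — (DESC) to `K̄₁` (★ `finrank_cechH1_structureSheaf_eq_dim_of_algClosure`) + (GEO) over `K̄₁`
(★ (K′), level structure §1, ★ constancy of `K(L₀)_{K̄₁}`, Mumford's construction §0, HEAD ★ `finite_finrank_cechH1_eq_of_poincareData`).
[cite: MumfordAV1970, §13 Cor. 2 (p. 129), §13 Theorem (p. 125) and §23 (p. 231)] [cite: StacksProject, Tag 02KH]
[cite: MumfordFogartyKirwan1994, Ch. 6 §1 Cor. 6.8 (p. 118) and Ch. 7 §2 Def. 7.1 (p. 129)] -/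
theorem finite_finrank_cechH1_eq_of_letter_geometricPoint (K₁ : Type) [Field K₁] (B : AbelianSchemeOver (Spec (.of K₁)))
    (hB : IsProjective B.X.hom) (M : B.left.Modules) (hM : HasRank M 1)
    (hεM : CechPic.pullback B.unitSection (detClass (HasRank.isFiniteLocallyFree' hM)) = 1)
    (hΘM : ∀ ⦃Ω : Type⦄ [Field Ω] [IsAlgClosed Ω] (t : Spec (.of Ω) ⟶ Spec (.of K₁)),
      ∃ Θ : CartierDivisor (B.fibre t).toAbelianVariety.X.left, Θ.IsAmple ∧
        CechPic.pullback (X := (B.fibre t).toAbelianVariety.X.left) (pullback.fst B.X.hom t)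
          (detClass (HasRank.isFiniteLocallyFree' hM)) = Θ.cechClass)
    (n : ℕ) [NeZero n] (hn : IsUnit ((n : ℕ) : K₁))
    (hkillM : ∀ (T : Over (Spec (.of K₁))) (u : T ⟶ B.X), B.MemKOfL M u → u ^ n = 1)
    {g : ℕ} (hg : B.IsOfRelDim g) (Ω : Type) [Field Ω] [IsAlgClosed Ω] (t : Spec (.of Ω) ⟶ Spec (.of K₁))
    {κ : Type} [Finite κ] (U : κ → (B.baseChange t).X.left.Opens) (hU : ∀ i, IsAffineOpen (U i)) (hUcov : iSup U = ⊤) :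
    Module.Finite Ω (CechH1 (B.baseChange t).X.hom U) ∧ Module.finrank Ω (CechH1 (B.baseChange t).X.hom U) = g := by
  classical
  -- (K′) over `K₁`
  obtain ⟨Z, i, hci, -, hZet, hin, hZ⟩ := B.exists_kOfL_etale_of_isUnit hM hεM hn hkillM hΘM
  haveI := hci
  haveI := hZet
  -- the data transported to `B_Ω = B.baseChange t`
  have hg' : (B.baseChange t).IsOfRelDim g := hg.baseChange t
  have hM' : HasRank ((Scheme.Modules.pullback (pullback.fst B.X.hom t)).obj M) 1 := hasRank_pullback _ hM
  have hε' := B.pullback_unitSection_detClass_baseChange_eq_one t hM hεM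
  have hB' : IsProjective (B.baseChange t).X.hom := by
    rw [AbelianSchemeOver.baseChange_hom]
    exact hB.pullback_snd t
  have hnΩ : IsUnit ((n : ℕ) : Ω) := by
    have h := hn.map (Spec.preimage t).hom
    rwa [map_natCast] at h
  have hres : ∀ x : ↥(Spec (.of Ω)), (n : (Spec (.of Ω)).residueField x) ≠ 0 :=
    AbelianSchemeOver.natCast_residueField_spec_ne_zero_of_isUnit Ω hnΩ
  -- a level-`n` structure on `B_Ω`, hence `K(M)_Ω` is the constant group on finitely many sections
  obtain ⟨φ⟩ := nonempty_levelStructure_baseChange_of_isAlgClosed B Ω t hg' n hnΩ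
  obtain ⟨K', hK'fin, hKinj, hK'⟩ := B.exists_finite_subgroup_memKOfL_iff_baseChange M hM hεM i hZ hin t hres φ
  haveI := hK'fin
  -- Mumford's `(B_Ω⁄K(M), π, 𝒫)`, `Â` of relative dimension `g`
  obtain ⟨hat, π, hπmon, -, hπet, hπsurj, P, hker, hP1, -, hpic, hsock, -, hrd⟩ :=
    B.exists_quotient_poincare_relDim_of_constant_kOfL_baseChange_of_isLocallyNoetherian hM hεM t hB' K' hKinj hK'
  haveI := hπmon
  haveI := hπet
  haveI := hπsurj
  haveI : Flat π.left := inferInstance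
  haveI : IsProper (B.baseChange t).X.hom := (B.baseChange t).isProper
  haveI : Smooth (B.baseChange t).X.hom := (B.baseChange t).isSmooth
  haveI : GeometricallyIntegral (B.baseChange t).X.hom := (B.baseChange t).geometricallyIntegral_hom_overBase
  haveI : Flat (B.baseChange t).X.hom := inferInstance
  haveI : LocallyOfFinitePresentation (B.baseChange t).X.hom := inferInstance
  haveI : UniversallyOpen (B.baseChange t).X.hom := inferInstance
  -- the HEAD
  exact (B.baseChange t).finite_finrank_cechH1_eq_of_poincareData hat π hM' hε' hker P hsock hP1 (hpic Ω) hg' (hrd g hg')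
    U hU hUcov

/-- **[MumfordAV1970] §13 Cor. 2 FOR THE DUALS LETTER'S DATA OVER ANY FIELD**: for `A₀ → Spec K₁` a PROJECTIVE abelian scheme, `L₀` rank one rigidified
along the unit section with ample class on every geometric fibre, and `n ∈ K₁^×` with `K(L₀)` killed by `n`: for every finite affine open cover `𝔘` of
`A₀`, `Ȟ¹(𝔘, 𝒪)` is a finite `K₁`-module of rank `dim A₀` — (DESC) to `K̄₁` (★ `finrank_cechH1_structureSheaf_eq_dim_of_algClosure`; `(A₀)_{K̄₁}` as
`AbelianSchemeOver.baseChange` and as ★ `AbelianVariety.baseChange` agree by `rfl`) + (GEO) at the geometric point `Spec K̄₁ → Spec K₁` (previous theorem).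
[cite: MumfordAV1970, §13 Cor. 2 (p. 129), §13 Theorem (p. 125) and §23 (p. 231)] [cite: StacksProject, Tag 02KH]
[cite: MumfordFogartyKirwan1994, Ch. 6 §1 Cor. 6.8 (p. 118) and Ch. 7 §2 Def. 7.1 (p. 129)] -/
theorem finite_finrank_cechH1_eq_dim_of_letter_field (K₁ : Type) [Field K₁] (B : AbelianSchemeOver (Spec (.of K₁)))
    (hB : IsProjective B.X.hom) (M : B.left.Modules) (hM : HasRank M 1)
    (hεM : CechPic.pullback B.unitSection (detClass (HasRank.isFiniteLocallyFree' hM)) = 1)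
    (hΘM : ∀ ⦃Ω : Type⦄ [Field Ω] [IsAlgClosed Ω] (t : Spec (.of Ω) ⟶ Spec (.of K₁)),
      ∃ Θ : CartierDivisor (B.fibre t).toAbelianVariety.X.left, Θ.IsAmple ∧
        CechPic.pullback (X := (B.fibre t).toAbelianVariety.X.left) (pullback.fst B.X.hom t)
          (detClass (HasRank.isFiniteLocallyFree' hM)) = Θ.cechClass)
    (n : ℕ) [NeZero n] (hn : IsUnit ((n : ℕ) : K₁))
    (hkillM : ∀ (T : Over (Spec (.of K₁))) (u : T ⟶ B.X), B.MemKOfL M u → u ^ n = 1)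
    {J : Type} [Finite J] (U : J → B.X.left.Opens) (hU : ∀ i, IsAffineOpen (U i)) (hUcov : iSup U = ⊤) :
    Module.Finite K₁ (CechH1 B.X.hom U) ∧ Module.finrank K₁ (CechH1 B.X.hom U) = B.toAffine.toAbelianVariety.dim := by
  classical
  obtain ⟨g, hg⟩ := B.exists_isOfRelDim
  -- `(A₀)_{K̄₁}`: the `AbelianSchemeOver` base change IS the ★ `AbelianVariety.baseChange` (LA4-p05 (g2))
  have hV : (B.baseChange (Spec.map (CommRingCat.ofHom (algebraMap K₁ (AlgebraicClosure K₁))))).toAffine.toAbelianVariety =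
      B.toAffine.toAbelianVariety.baseChange (AlgebraicClosure K₁) := rfl
  have hdim : (B.baseChange (Spec.map (CommRingCat.ofHom (algebraMap K₁ (AlgebraicClosure K₁))))).toAffine.toAbelianVariety.dim = g :=
    AbelianSchemeOver.dim_toAbelianVariety_of_isOfRelDim (hg.baseChange _)
  -- (GEO) at the geometric point `Spec K̄₁ → Spec K₁`, in the tokens of (DESC)
  have key : ∀ {κ' : Type} [Finite κ']
      (U' : κ' → (B.baseChange (Spec.map (CommRingCat.ofHom (algebraMap K₁ (AlgebraicClosure K₁))))).toAffine.toAbelianVariety.X.left.Opens),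
      (∀ i, IsAffineOpen (U' i)) → iSup U' = ⊤ →
      Module.Finite (AlgebraicClosure K₁)
          (CechH1 (B.baseChange (Spec.map (CommRingCat.ofHom (algebraMap K₁ (AlgebraicClosure K₁))))).toAffine.toAbelianVariety.X.hom U') ∧
        Module.finrank (AlgebraicClosure K₁)
          (CechH1 (B.baseChange (Spec.map (CommRingCat.ofHom (algebraMap K₁ (AlgebraicClosure K₁))))).toAffine.toAbelianVariety.X.hom U') =
          (B.baseChange (Spec.map (CommRingCat.ofHom (algebraMap K₁ (AlgebraicClosure K₁))))).toAffine.toAbelianVariety.dim := by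
    intro κ' _ U' hU' hU'cov
    rw [hdim]
    exact finite_finrank_cechH1_eq_of_letter_geometricPoint K₁ B hB M hM hεM hΘM n hn hkillM hg (AlgebraicClosure K₁)
      (Spec.map (CommRingCat.ofHom (algebraMap K₁ (AlgebraicClosure K₁)))) U' hU' hU'cov
  rw [hV] at key
  -- (DESC)
  exact AbelianVarieties.finrank_cechH1_structureSheaf_eq_dim_of_algClosure B.toAffine.toAbelianVariety key U hU hUcov

/-- **THE CHAIN'S `hH1` FROM THE DUALS LETTER'S DATA** — the uniform `H¹`-count hypothesis of ★ `MumfordDual.nonempty_dualPair_of_isProjective_of_split` (file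
(4)), threaded through ★ (3) `existsUnique_classify` → (2) `graphPoint_tower` → (1) `PoincareFamilyKSSurjectiveAnyChar`, DISCHARGED: for `A → Spec R`
projective abelian over a Noetherian ring with the letter's `(L, hL, hε, hΘ, n ∈ R^×, hkill)`, at every field point `s` of every base change `A ×_R S′`
and every finite affine open cover of the fibre, `Ȟ¹(𝔘, 𝒪)` is finite of rank the dimension — the previous theorem at the fibre `(A ×_R S′)_s`, whose
data are the letter's carried along the two cartesian squares (★ `IsBaseChangeVia.trans` and its transports).
[cite: MumfordAV1970, §13 Cor. 2 (p. 129) and §13 Theorem (p. 125)] [cite: MumfordFogartyKirwan1994, Ch. 6 §1 Cor. 6.8 (p. 118)] -/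
theorem hH1_of_letter (R : Type) [CommRing R] [IsNoetherianRing R] (A : AbelianSchemeOver (Spec (.of R))) (hA : IsProjective A.X.hom)
    (L : A.left.Modules) (hL : HasRank L 1)
    (hε : CechPic.pullback A.unitSection (detClass (HasRank.isFiniteLocallyFree' hL)) = 1)
    (hΘ : ∀ ⦃Ω : Type⦄ [Field Ω] [IsAlgClosed Ω] (s : Spec (.of Ω) ⟶ Spec (.of R)),
      ∃ Θ : CartierDivisor (A.fibre s).toAbelianVariety.X.left, Θ.IsAmple ∧
        CechPic.pullback (X := (A.fibre s).toAbelianVariety.X.left) (pullback.fst A.X.hom s)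
          (detClass (HasRank.isFiniteLocallyFree' hL)) = Θ.cechClass)
    (n : ℕ) [NeZero n] (hn : IsUnit ((n : ℕ) : R))
    (hkill : ∀ (T : Over (Spec (.of R))) (u : T ⟶ A.X), A.MemKOfL L u → u ^ n = 1)
    {S' : Scheme.{0}} (p : S' ⟶ Spec (.of R)) (K₁ : Type) [Field K₁] (s : Spec (.of K₁) ⟶ S') {J : Type} [Finite J]
    (U : J → ((A.baseChange p).X ⊗ Over.mk s).left.Opens) (hU : ∀ i, IsAffineOpen (U i)) (hUcov : iSup U = ⊤) :
    Module.Finite K₁ (CechH1 (X := ((A.baseChange p).X ⊗ Over.mk s).left) (Limits.pullback.snd (A.baseChange p).X.hom s) U) ∧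
      Module.finrank K₁ (CechH1 (X := ((A.baseChange p).X ⊗ Over.mk s).left) (Limits.pullback.snd (A.baseChange p).X.hom s) U) =
        ((A.baseChange p).fibre s).toAbelianVariety.dim := by
  -- (K′) on `Spec R`
  obtain ⟨Z, i, -, -, -, hin, hZ⟩ := A.exists_kOfL_etale_of_isUnit hL hε hn hkill hΘ
  -- the fibre `B := (A ×_R S′)_s` as a base change of `A` along `s ≫ p`
  have hbc : ((A.baseChange p).baseChange s).IsBaseChangeVia A (s ≫ p)
      (pullback.fst (A.baseChange p).X.hom s ≫ pullback.fst A.X.hom p) :=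
    ((A.baseChange p).baseChange_isBaseChangeVia s).trans (A.baseChange_isBaseChangeVia p)
  have hB : IsProjective ((A.baseChange p).baseChange s).X.hom := by
    have h₁ : IsProjective (A.baseChange p).X.hom := by
      rw [AbelianSchemeOver.baseChange_hom]
      exact hA.pullback_snd p
    rw [AbelianSchemeOver.baseChange_hom]
    exact h₁.pullback_snd s
  have hn' : IsUnit ((n : ℕ) : K₁) := by
    have h := hn.map (Spec.preimage (s ≫ p)).hom
    rwa [map_natCast] at h
  exact finite_finrank_cechH1_eq_dim_of_letter_field K₁ ((A.baseChange p).baseChange s) hB _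
    (hasRank_pullback (pullback.fst (A.baseChange p).X.hom s ≫ pullback.fst A.X.hom p) hL)
    (hbc.pullback_unitSection_detClass_pullback_eq_one hL hε)
    (fun Ω _ _ t => hbc.exists_isAmple_cechClass_fibre_pullback hL hΘ t) n hn'
    (fun T u hu => hbc.pow_eq_one_of_memKOfL_pullback hL i hZ hin u hu) U hU hUcov

end MumfordDual

end Literature.AlgebraicGeometry.AbelianSchemes

end
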